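import Literature.Barriers.ResolutionOfSingularities.RegularNotGeometricallyRegular
import Literature.Algebra.Polynomial.AffineSliceCalculus
import Literature.AlgebraicGeometry.Motives.CyclesDimensionProofs
import Mathlib.RingTheory.Polynomial.GaussLemma
import Mathlib.FieldTheory.KummerPolynomial
import Mathlib.FieldTheory.RatFunc.Degree
import Mathlib.Algebra.Polynomial.Taylor
import Mathlib.RingTheory.RegularLocalRing.Polynomial
import HarnessLib

/-!
# [OURS · L1 W8.2] Kollár's curve `y^q = x^p − t` over `𝔽_p(t)` is a REGULAR, GEOMETRICALLY INTEGRAL plane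
# curve — the commutative algebra behind the exponent-zero negative lemma of slot W8.2

Cell `res-hironaka` (run/shared/lean/pub/res-hironaka/), LADDER-RESOLUTION rung L (RESCUE), slot W8.2 of
plan/RESCUE-SEED.md («PRIME-FIELD / UNIVERSALITY TRANSFER instead of descent»), host route `UniversalCells`, host
item `PrimeFieldToPerfect` (stmt-ResolutionOfSingularities-15233). Proofs only (no definitions, no named facts,
Theses-free), written by the slot's prover res-L1-s82-pv-1 (gen 3). Consumed by the sibling
Theorems/UniversalCellsCampaignW82ExponentZeroProofs.lean, which shows that the residual of slot W8.2 in its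
regular Frobenius-twist normal form (`CampaignW82.FrobeniusTwistStepRegularAt`, p485672) becomes FALSE at the
first grade when the Frobenius exponent is pinned to `0` — with THIS curve as the witness.

The barrier entry `Literature.Barriers.ResolutionOfSingularities.RegularNotGeometricallyRegular` (Kollár 2007,
1.19; Liu 2002, Ex. 7.3.15) proves the two LOCAL facts about `A = k[X,Y]/(Y^q − X^p + t)`, `k = 𝔽_p(t)`
(`baseField p`): the local ring at the inseparable point `𝔭 = (X^p − t, Y)` is regular
(`isRegularLocalRing_kollarPoint`), and after `k → K = k(t^{1/p})` the point over it is not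
(`not_isRegularLocalRing_cuspIdeal`); its scope caveat (b) lists what it does NOT formalise: "that `A` is a
domain and `Spec A` is regular at its OTHER points …, geometric integrality of `C` for `gcd(p, q) = 1`". This
file supplies exactly those global facts, for every exponent `q` PRIME TO `p` (`q ≥ 2`):

* §1–§2 `irreducible_X_pow_sub_C_of_not_dvd_natDegree`: `Y^p − a(T)` is irreducible in `F[T][Y]` for any field
  `F`, `p` prime, `p ∤ deg a` (Gauss's lemma over the normal domain `F[T]`, Mathlib
  `Polynomial.Monic.irreducible_iff_irreducible_map_fraction_map`; Kummer's criterion over `F(T)`, Mathlib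
  `X_pow_sub_C_irreducible_of_prime`; `a` is not a `p`-th power by the degree count in `RatFunc F`);
  `irreducible_X_sub_C_pow_sub_X_pow`: hence `(X₀ − c)^p − X₁^q` is irreducible in `F[X₀, X₁]` (transport along
  the slicing isomorphism `F[X₀,X₁] ≃ F[T][Y]` of `Literature.Algebra.Polynomial.AffineSliceCalculus` and a
  Taylor shift); `isDomain_quotient_twist`.
* §3 `isDomain_tensor_kollarRing`: for every field `L ⊇ k` containing a `p`-th root `c` of `t`,
  `L ⊗ₖ A ≅ L[X,Y]/((X − c)^p − Y^q)` is a DOMAIN — geometric integrality of `C` at every purely inseparable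
  level `k(t^{1/p^e})`, `e ≥ 1`, and over every perfect field over `k`.
* §4 `isRegularRing_kollarRing`: `A` is a REGULAR ring: at `𝔭` by the barrier entry; at every other prime
  `𝔮 ∌ Y`, `∂f/∂Y = qY^{q−1} ∉ 𝔮` forces `f ∉ 𝔪_𝔮²` (`kollarPoly_not_mem_sq`: a derivation maps `𝔮²` into `𝔮`)
  and `k[X,Y]_𝔮/(f)` is regular (Matsumura 14.2, tree `IsRegularLocalRing.quotient_span_singleton`); primes
  containing `Y` are `𝔭` (`eq_kollarPoint_of_mem`: the quotient map factors through `k[X,Y] → k(t^{1/p})`).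
* §5 `ringKrullDim_kollarRing`: `dim A = 1` (a plane curve: tree
  `Motives.MvPolynomial.ringKrullDim_quotient_span_singleton`).

HONEST FRAMING. OURS supporting lemmas of the campaign; the exponent `q` is a parameter (the sibling file uses
`q = p + 1`); nothing here is a statement of H. Hironaka's manuscript [Hironaka2017] and nothing is attributed
to its author. Everything is a theorem; no `sorry`, no new axioms. AI work, weaker than expert review.

## References (locators; nothing cited as a premise)
* J. Kollár, *Lectures on Resolution of Singularities* (2007), 1.19 "Curves over nonperfect fields" ("the only
  point in question is `(t^{1/p}, 0)`"). [Kollar2007]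
* Q. Liu, *Algebraic Geometry and Arithmetic Curves* (2002), Example 7.3.15 ("normal projective curves that are
  geometrically integral and not smooth"), Remark 4.3.34. [Liu2002]
* H. Matsumura, *Commutative Ring Theory* (1986), Thm. 14.2. [Matsumura1987]
-/

noncomputable section

set_option linter.dupNamespace false -- mandated namespace of this single-conjunct summit

open Polynomial IsLocalRing TensorProduct
open Literature.Barriers.ResolutionOfSingularities Literature.AlgebraicGeometry.Resolution

namespace Summit.ResolutionOfSingularities.ResolutionOfSingularities.Theorems.CampaignW82.KollarCurve

/-! ## §1 `Y^p − a(T)` is irreducible in `F[T][Y]` when `p ∤ deg a` -/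

/-- `intDegree (b ^ n) = n * intDegree b` for a nonzero rational function. [folklore] -/
theorem intDegree_pow {F : Type*} [Field F] {b : RatFunc F} (hb : b ≠ 0) (n : ℕ) :
    RatFunc.intDegree (b ^ n) = n * RatFunc.intDegree b := by
  induction n with
  | zero => simp
  | succ n ih =>
    rw [pow_succ, RatFunc.intDegree_mul (pow_ne_zero n hb) hb, ih]
    push_cast
    ring

/-- **`Y^p − a` is irreducible over `F[T]` when `p` is prime and `p ∤ deg a`** (`a ≠ 0`): by
Gauss's lemma it suffices to work over `F(T)`, where `Y^p − a` is irreducible unless `a` is a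
`p`-th power (Kummer), which the degree count `p · deg b = deg a` excludes. [folklore] -/
theorem irreducible_X_pow_sub_C_of_not_dvd_natDegree (F : Type*) [Field F] {p : ℕ}
    (hp : p.Prime) {a : F[X]} (ha0 : a ≠ 0) (hdeg : ¬ p ∣ a.natDegree) :
    Irreducible (X ^ p - C a : F[X][X]) := by
  have hmonic : (X ^ p - C a : F[X][X]).Monic := monic_X_pow_sub_C a hp.ne_zero
  rw [hmonic.irreducible_iff_irreducible_map_fraction_map (K := RatFunc F)]
  simp only [Polynomial.map_sub, Polynomial.map_pow, map_X, map_C]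
  refine X_pow_sub_C_irreducible_of_prime hp fun b hb => ?_
  have ha' : (algebraMap F[X] (RatFunc F) a) ≠ 0 := by
    intro h
    exact ha0 ((map_eq_zero_iff _ (IsFractionRing.injective F[X] (RatFunc F))).mp h)
  have hb0 : b ≠ 0 := by
    rintro rfl
    rw [zero_pow hp.ne_zero] at hb
    exact ha' hb.symm
  have h1 := congrArg RatFunc.intDegree hb
  rw [intDegree_pow hb0, RatFunc.intDegree_polynomial] at h1
  exact hdeg (Int.natCast_dvd_natCast.mp ⟨_, h1.symm⟩)

/-! ## §2 The twisted equation `(X₀ − c)^p − X₁^q` is irreducible in `F[X₀, X₁]` -/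

/-- For any field `F`, `c ∈ F`, `p` prime and `p ∤ q`: the bivariate polynomial
`(X₀ − c)^p − X₁^q` is irreducible in `F[X₀, X₁]` — under the slicing isomorphism
`F[X₀, X₁] ≃ F[T][Y]` (`X₀ ↦ Y`, `X₁ ↦ T`) it is the Taylor shift `Y ↦ Y − c` of `Y^p − T^q`.
[folklore] -/
theorem irreducible_X_sub_C_pow_sub_X_pow (F : Type*) [Field F] (c : F) {p q : ℕ} (hp : p.Prime)
    (hpq : ¬ p ∣ q) :
    Irreducible ((MvPolynomial.X 0 - MvPolynomial.C c) ^ p - MvPolynomial.X 1 ^ q :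
      MvPolynomial (Fin 2) F) := by
  -- the slicing isomorphism `e : F[X₀,X₁] ≃ F[T][Y]`
  let e : MvPolynomial (Fin 2) F ≃ₐ[F] F[X][X] :=
    (MvPolynomial.finSuccEquiv F 1).trans (Polynomial.mapAlgEquiv (MvPolynomial.uniqueAlgEquiv F (Fin 1)))
  have heX0 : e (MvPolynomial.X 0) = Polynomial.X := Literature.Algebra.Polynomial.finTwoSlice_X_zero F
  have heX1 : e (MvPolynomial.X 1) = Polynomial.C Polynomial.X :=
    Literature.Algebra.Polynomial.finTwoSlice_X_one F
  have heC : e (MvPolynomial.C c) = Polynomial.C (Polynomial.C c) :=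
    Literature.Algebra.Polynomial.finTwoSlice_C F c
  -- `Y^p − T^q` is irreducible, hence so is its Taylor shift `(Y − c)^p − T^q`
  have hirr : Irreducible (X ^ p - C (X ^ q) : F[X][X]) :=
    irreducible_X_pow_sub_C_of_not_dvd_natDegree F hp (pow_ne_zero q X_ne_zero)
      (by rwa [natDegree_X_pow])
  have hshift : taylorEquiv (-(C c : F[X])) (X ^ p - C (X ^ q) : F[X][X]) =
      (X - C (C c)) ^ p - C (X ^ q) := by
    show taylor (-(C c : F[X])) (X ^ p - C (X ^ q) : F[X][X]) = _
    rw [map_sub, taylor_X_pow, taylor_C, map_neg, ← sub_eq_add_neg]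
  have hirr' : Irreducible ((X - C (C c)) ^ p - C (X ^ q) : F[X][X]) := by
    rw [← hshift]
    exact (MulEquiv.irreducible_iff (taylorEquiv (-(C c : F[X]))).toMulEquiv).mpr hirr
  -- transport back along `e`
  have himg : e ((MvPolynomial.X 0 - MvPolynomial.C c) ^ p - MvPolynomial.X 1 ^ q) =
      (X - C (C c)) ^ p - C (X ^ q) := by
    rw [map_sub, map_pow, map_pow, map_sub, heX0, heC, heX1, ← C_pow]
  exact (MulEquiv.irreducible_iff e.toMulEquiv).mp (himg ▸ hirr')

/-- Hence `F[X₀, X₁] / ((X₀ − c)^p − X₁^q)` is a domain (`F[X₀, X₁]` is factorial). [folklore] -/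
theorem isDomain_quotient_twist (F : Type*) [Field F] (c : F) {p q : ℕ} (hp : p.Prime)
    (hpq : ¬ p ∣ q) :
    IsDomain (MvPolynomial (Fin 2) F ⧸
      Ideal.span {((MvPolynomial.X 0 - MvPolynomial.C c) ^ p - MvPolynomial.X 1 ^ q :
        MvPolynomial (Fin 2) F)}) := by
  have hprime := (irreducible_X_sub_C_pow_sub_X_pow F c hp hpq).prime
  rw [Ideal.Quotient.isDomain_iff_prime]
  exact (Ideal.span_singleton_prime hprime.ne_zero).mpr hprime

/-! ## §3 Geometric integrality: `L ⊗ₖ A` is a domain whenever `t` is a `p`-th power in `L` -/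

section Kollar

variable (p : ℕ) [hp : Fact p.Prime] (q : ℕ) [hq : Fact (1 < q)]

omit hq in
/-- Over a field `L ⊇ k = 𝔽_p(t)` in which `t = c^p`, the image of `f = Y^q − X^p + t` is
`−((X − c)^p − Y^q)` (Frobenius: `(X − c)^p = X^p − c^p`). [folklore] -/
theorem map_kollarPoly_eq (L : Type) [Field L] [Algebra (baseField p) L] (c : L)
    (hc : c ^ p = algebraMap (baseField p) L RatFunc.X) :
    MvPolynomial.map (algebraMap (baseField p) L) (kollarPoly p q) =
      -((MvPolynomial.X 0 - MvPolynomial.C c) ^ p - MvPolynomial.X 1 ^ q) := by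
  haveI : CharP L p := charP_of_injective_algebraMap (algebraMap (baseField p) L).injective p
  simp only [kollarPoly, map_sub, map_add, map_pow, MvPolynomial.map_X, MvPolynomial.map_C, ← hc]
  rw [sub_pow_char (MvPolynomial.X 0) (MvPolynomial.C c), ← MvPolynomial.C_pow]
  ring

omit hq in
/-- **The Kollár curve is geometrically integral at the relevant levels**: for every field
`L ⊇ k = 𝔽_p(t)` containing a `p`-th root of `t` (every purely inseparable level `k(t^{1/p^e})`,
`e ≥ 1`, and every perfect field over `k`) and every exponent `q` prime to `p`,
`L ⊗ₖ k[X,Y]/(Y^q − X^p + t) ≅ L[X,Y]/((X − t^{1/p})^p − Y^q)` is a DOMAIN. This is the part of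
Kollár 2007, 1.19 / Liu 2002, Ex. 7.3.15 ("geometrically integral") that the barrier entry
`RegularNotGeometricallyRegular` left unformalised (scope caveat (b)). [cite: Liu2002, Example 7.3.15 and Remark 4.3.34] -/
theorem isDomain_tensor_kollarRing (hpq : ¬ p ∣ q) (L : Type) [Field L] [Algebra (baseField p) L]
    (c : L) (hc : c ^ p = algebraMap (baseField p) L RatFunc.X) :
    IsDomain (L ⊗[baseField p] kollarRing p q) := by
  -- `L ⊗ₖ (k[X,Y]/(f)) ≅ L[X,Y]/(f_L)`
  let e : L ⊗[baseField p] kollarRing p q ≃ₐ[L]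
      MvPolynomial (Fin 2) L ⧸ Ideal.span {MvPolynomial.map (algebraMap (baseField p) L) (kollarPoly p q)} :=
    (Algebra.TensorProduct.tensorQuotientEquiv (R := baseField p) L
        (MvPolynomial (Fin 2) (baseField p)) L (Ideal.span {kollarPoly p q})).trans
      (Ideal.quotientEquivAlg _ _ (MvPolynomial.algebraTensorAlgEquiv (baseField p) L) (by
        rw [Ideal.map_span, Set.image_singleton, Ideal.map_span, Set.image_singleton]
        congr 1
        ext1
        simp [Algebra.TensorProduct.includeRight_apply]))
  rw [map_kollarPoly_eq p q L c hc, Ideal.span_singleton_neg] at e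
  haveI := isDomain_quotient_twist L c hp.out hpq
  exact e.toMulEquiv.isDomain _

/-! ## §4 Regularity of `A = k[X,Y]/(Y^q − X^p + t)` at every prime (for `p ∤ q`) -/

/-- A derivation maps the square of an ideal into the ideal. [folklore] -/
theorem derivation_apply_mem_of_mem_sq {R : Type*} [CommRing R] {A : Type*} [CommRing A]
    [Algebra R A] (D : Derivation R A A) (I : Ideal A) {z : A} (hz : z ∈ I ^ 2) : D z ∈ I := by
  rw [pow_two] at hz
  refine Submodule.mul_induction_on hz (fun a ha b hb => ?_) (fun x y hx hy => ?_)
  · rw [D.leibniz, smul_eq_mul, smul_eq_mul]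
    exact I.add_mem (I.mul_mem_right _ ha) (I.mul_mem_right _ hb)
  · rw [map_add]; exact I.add_mem hx hy

omit hq in
/-- At a prime `Q ∌ Y` of `k[X,Y]` containing `f = Y^q − X^p + t` (`p ∤ q`), `f ∉ Q^{(2)}`:
otherwise `∂f/∂Y = q Y^{q−1} ∈ Q`. [folklore] -/
theorem kollarPoly_not_mem_sq (hpq : ¬ p ∣ q) (Q : Ideal (MvPolynomial (Fin 2) (baseField p)))
    [Q.IsPrime] (hY : MvPolynomial.X 1 ∉ Q) :
    algebraMap _ (Localization.AtPrime Q) (kollarPoly p q) ∉ (maximalIdeal _) ^ 2 := by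
  intro h
  rw [← Localization.AtPrime.map_eq_maximalIdeal, ← Ideal.map_pow,
    IsLocalization.mem_map_algebraMap_iff Q.primeCompl] at h
  obtain ⟨⟨⟨i, hi⟩, ⟨s, hs⟩⟩, h⟩ := h
  simp only at h
  rw [← map_mul] at h
  have hinj : Function.Injective (algebraMap (MvPolynomial (Fin 2) (baseField p)) (Localization.AtPrime Q)) :=
    IsLocalization.injective _ Q.primeCompl_le_nonZeroDivisors
  have hmem : kollarPoly p q * s ∈ Q ^ 2 := by rw [hinj h]; exact hi
  -- apply `∂/∂Y`
  have hD := derivation_apply_mem_of_mem_sq (MvPolynomial.pderiv 1) Q hmem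
  have hfQ : kollarPoly p q ∈ Q := by
    have := Ideal.pow_le_self two_ne_zero hmem
    exact ((Ideal.IsPrime.mem_or_mem ‹_› this).resolve_right hs)
  rw [Derivation.leibniz, smul_eq_mul, smul_eq_mul] at hD
  have h2 : s * MvPolynomial.pderiv 1 (kollarPoly p q) ∈ Q := by
    have h3 : kollarPoly p q * MvPolynomial.pderiv 1 s ∈ Q := Q.mul_mem_right _ hfQ
    simpa using (Submodule.sub_mem _ hD h3)
  have h4 : MvPolynomial.pderiv 1 (kollarPoly p q) ∈ Q :=
    ((Ideal.IsPrime.mem_or_mem ‹_› h2).resolve_left hs)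
  have hder : MvPolynomial.pderiv 1 (kollarPoly p q) =
      (q : MvPolynomial (Fin 2) (baseField p)) * MvPolynomial.X 1 ^ (q - 1) := by
    have h01 : (0 : Fin 2) ≠ 1 := by decide
    simp only [kollarPoly, map_add, map_sub, Derivation.leibniz_pow, MvPolynomial.pderiv_X_self,
      MvPolynomial.pderiv_X_of_ne h01, MvPolynomial.pderiv_C, mul_zero, sub_zero, add_zero,
      smul_eq_mul, mul_one, nsmul_eq_mul]
  rw [hder] at h4
  have hqK : (q : baseField p) ≠ 0 := by
    intro h0
    exact hpq ((CharP.cast_eq_zero_iff (baseField p) p q).mp h0)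
  have hunit : IsUnit (q : MvPolynomial (Fin 2) (baseField p)) := by
    rw [← map_natCast (MvPolynomial.C (σ := Fin 2) (R := baseField p)) q]
    exact (isUnit_iff_ne_zero.mpr hqK).map _
  rw [Ideal.unit_mul_mem_iff_mem _ hunit] at h4
  exact hY (Ideal.IsPrime.mem_of_pow_mem ‹_› _ h4)

/-- A prime of `A = k[X,Y]/(f)` containing `ȳ` is the point `𝔭 = (X^p − t, Y)/(f)`: the quotient
map `k[X,Y] → A/𝔮` kills `Y` and `X^p − t = Y^q − f`, hence factors through
`k[X,Y] → k(t^{1/p})`, `X ↦ t^{1/p}`, `Y ↦ 0`, whose kernel is `𝔮₀ = (X^p − t, Y)`. [folklore] -/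
theorem eq_kollarPoint_of_mem (Q : Ideal (kollarRing p q)) [Q.IsPrime]
    (hY : Ideal.Quotient.mk _ (MvPolynomial.X 1) ∈ Q) : Q = kollarPoint p q := by
  have hq0 : q ≠ 0 := by have := hq.out; omega
  -- `ψ : k[X,Y] → A/Q`
  let ψ : MvPolynomial (Fin 2) (baseField p) →ₐ[baseField p] kollarRing p q ⧸ Q :=
    (Ideal.Quotient.mkₐ (baseField p) Q).comp
      (Ideal.Quotient.mkₐ (baseField p) (Ideal.span {kollarPoly p q}))
  have hψY : ψ (MvPolynomial.X 1) = 0 := by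
    simpa [ψ] using (Ideal.Quotient.eq_zero_iff_mem.mpr hY)
  have hψf : ψ (kollarPoly p q) = 0 := by
    simp only [ψ, AlgHom.comp_apply, Ideal.Quotient.mkₐ_eq_mk,
      Ideal.Quotient.eq_zero_iff_mem.mpr (Ideal.subset_span rfl : kollarPoly p q ∈ Ideal.span {kollarPoly p q}),
      map_zero]
  have hψX : (ψ (MvPolynomial.X 0)) ^ p =
      (algebraMap (baseField p) (kollarRing p q ⧸ Q) : baseField p →+* kollarRing p q ⧸ Q)
        RatFunc.X := by
    have h1 : ψ (MvPolynomial.X 0 ^ p - MvPolynomial.C RatFunc.X) = 0 := by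
      have : MvPolynomial.X 0 ^ p - MvPolynomial.C RatFunc.X =
          MvPolynomial.X 1 ^ q - kollarPoly p q := by rw [kollarPoly]; ring
      rw [this, map_sub, hψf, sub_zero, map_pow, hψY]
      exact zero_pow (M₀ := kollarRing p q ⧸ Q) hq0
    rw [map_sub, map_pow, MvPolynomial.algHom_C, sub_eq_zero] at h1
    exact h1
  -- factor through `pointHom`
  let χ : extField p →ₐ[baseField p] kollarRing p q ⧸ Q :=
    AdjoinRoot.liftAlgHom (insepPoly p) (Algebra.ofId (baseField p) (kollarRing p q ⧸ Q))
      (ψ (MvPolynomial.X 0)) (by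
        simp only [insepPoly, eval₂_sub, eval₂_X_pow, eval₂_C, hψX]
        exact sub_self _)
  have hfac : χ.comp (pointHom p) = ψ := by
    refine MvPolynomial.algHom_ext fun i => ?_
    fin_cases i
    · simp [χ, pointHom_X_zero, AdjoinRoot.liftAlgHom_root]
    · simp [pointHom_X_one, hψY]
  -- hence `kollarPoint ≤ Q`
  have hle : kollarPoint p q ≤ Q := by
    rw [kollarPoint, Ideal.map_le_iff_le_comap]
    intro g hg
    have hg0 : pointHom p g = 0 := hg
    have : ψ g = 0 := by rw [← hfac, AlgHom.comp_apply, hg0, map_zero]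
    simpa [ψ, Ideal.Quotient.eq_zero_iff_mem] using this
  exact ((kollarPoint_isMaximal p q).eq_of_le (Ideal.IsPrime.ne_top ‹_›) hle).symm

/-- **The Kollár curve is regular (all of its local rings), for `p ∤ q`.** At the inseparable
point `𝔭 = (X^p − t, Y)` this is the barrier entry's `isRegularLocalRing_kollarPoint` (the thick
point shows `f ∉ 𝔪²`); at every other prime `Y` is a unit direction: `∂f/∂Y = qY^{q−1} ∉ 𝔮`
forces `f ∉ 𝔪_𝔮²`, and `k[X,Y]_𝔮/(f)` is regular by Matsumura 14.2. ("the only point in question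
is `(t^{1/p}, 0)`".) [cite: Kollar2007, 1.19 (Curves over nonperfect fields)] -/
theorem isRegularRing_kollarRing (hpq : ¬ p ∣ q) : IsRegularRing (kollarRing p q) := by
  rw [isRegularRing_iff]
  intro Q hQ
  by_cases hY : Ideal.Quotient.mk _ (MvPolynomial.X 1) ∈ Q
  · obtain rfl := eq_kollarPoint_of_mem p q Q hY
    exact isRegularLocalRing_kollarPoint p q
  · -- `Q = Q₀/(f)` with `Y ∉ Q₀`
    set Q₀ := Q.comap (Ideal.Quotient.mk (Ideal.span {kollarPoly p q})) with hQ₀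
    have hY₀ : MvPolynomial.X 1 ∉ Q₀ := hY
    have hfQ₀ : Ideal.span {kollarPoly p q} ≤ Q₀ := by
      rw [hQ₀, ← Ideal.map_le_iff_le_comap, Ideal.map_quotient_self]
      exact bot_le
    have hQeq : Q₀.map (Ideal.Quotient.mk (Ideal.span {kollarPoly p q})) = Q :=
      Ideal.map_comap_of_surjective _ Ideal.Quotient.mk_surjective Q
    have key : IsRegularLocalRing (Localization.AtPrime Q₀ ⧸
        (Ideal.span {kollarPoly p q}).map (algebraMap _ (Localization.AtPrime Q₀))) := by
      rw [Ideal.map_span, Set.image_singleton]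
      have hmem : algebraMap _ (Localization.AtPrime Q₀) (kollarPoly p q) ∈ maximalIdeal _ := by
        rw [← Localization.AtPrime.map_eq_maximalIdeal]
        exact Ideal.mem_map_of_mem _ (hfQ₀ (Ideal.subset_span rfl))
      exact (IsRegularLocalRing.quotient_span_singleton hmem (kollarPoly_not_mem_sq p q hpq Q₀ hY₀)).1
    haveI : (Q₀.map (Ideal.Quotient.mk (Ideal.span {kollarPoly p q}))).IsPrime := by rw [hQeq]; exact hQ
    have h := isRegularLocalRing_localization_map_mk (Ideal.span {kollarPoly p q}) Q₀ hfQ₀ key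
    -- transport along the equality of primes `Q₀/(f) = Q`
    have hS : (Q₀.map (Ideal.Quotient.mk (Ideal.span {kollarPoly p q}))).primeCompl = Q.primeCompl := by
      ext x; simp [Ideal.primeCompl, hQeq]
    haveI : IsLocalization.AtPrime
        (Localization.AtPrime (Q₀.map (Ideal.Quotient.mk (Ideal.span {kollarPoly p q})))) Q := by
      change IsLocalization Q.primeCompl _
      rw [← hS]
      infer_instance
    exact IsRegularLocalRing.of_ringEquiv
      (R := Localization.AtPrime (Q₀.map (Ideal.Quotient.mk (Ideal.span {kollarPoly p q}))))
      (IsLocalization.algEquiv Q.primeCompl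
        (Localization.AtPrime (Q₀.map (Ideal.Quotient.mk (Ideal.span {kollarPoly p q}))))
        (Localization.AtPrime Q)).toRingEquiv

/-! ## §5 Dimension one; nonzero, non-unit -/

/-- `f ≠ 0`. [folklore] -/
theorem kollarPoly_ne_zero : kollarPoly p q ≠ 0 := by
  intro h
  have := algebraMap_kollarPoly_not_mem_sq p q
  rw [h, map_zero] at this
  exact this (Submodule.zero_mem _)

/-- `f` is not a unit (it lies in the maximal ideal `𝔮₀`). [folklore] -/
theorem not_isUnit_kollarPoly : ¬ IsUnit (kollarPoly p q) := fun h =>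
  (pointIdeal_isMaximal p).ne_top (Ideal.eq_top_of_isUnit_mem _ (kollarPoly_mem_pointIdeal p q) h)

/-- **`dim k[X,Y]/(Y^q − X^p + t) = 1`** (a plane curve). [folklore] -/
theorem ringKrullDim_kollarRing : ringKrullDim (kollarRing p q) = 1 := by
  have := Literature.AlgebraicGeometry.Motives.MvPolynomial.ringKrullDim_quotient_span_singleton
    (baseField p) 1 (kollarPoly_ne_zero p q) (not_isUnit_kollarPoly p q)
  exact_mod_cast this

end Kollar

end Summit.ResolutionOfSingularities.ResolutionOfSingularities.Theorems.CampaignW82.KollarCurve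

end
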